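import Summits.QuantumFields.YangMills.Theorems.BalabanUVNodesN21ChartExponentCoercivity
import Summits.QuantumFields.YangMills.Theorems.BalabanUVNodesN21ChartExponentConvexityLocalSUN

/-!
# N21 (NE7c) · THE (1.9) BINDER OF THE (M1) ENDs ON pub-balaban's `BlockChartSU N b` FROM THE (1.7) ROW + PROVED (1.8),
# through an explicit BOND DICTIONARY `↥b ≃` off-tree bonds of a cube — and the dictionary EXISTS for every non-wrapping
# cube of the lane's torus (file 7 of WIDTH-209 N21 piece 2)

Width seat pub-ymgap-dag-n21-w3 (g4), node N21 = NE7c (NOT PRINTED, NOT proved), lane K3⁷ `SpineGivenEndpointR13SepCoPH`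
(stmt-QuantumFields-20544, `--kind proof --supports … --as helper`).  Companion of file 6 `…N21ChartExponentCoercivity`
(p616546: the flat-frame reading of `h19` from (1.7) + `B16Sect1Wilson.ineq18_cube_vec` + `ineq19_of_17_18`).

WHY.  The ENDs that matter for dag-n21-w2's JUNCTION №3 live on `BlockChartSU N b = ↥b → E_N` (dag-n21-w1 g2 p604008 ∕
p608182 ∕ p609856, dag-n21-w4 g2 p610497 ∕ p614928) and display `h19 : ∀ v, Ineq19 (Qf v) (Σ_{b′} ‖v b′‖²) γ₀ d M`.  Reading
it from print's (1.7) needs (1.8), and (1.8) needs the block's bond variables to BE the off-tree bonds of a cube in an axial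
(comb) gauge.  This file makes that identification an explicit DATUM — a bijection `e : ↥b ≃ ↥(innerBonds n y ∖ treeBonds n y)`
between the block's torus bonds and the off-tree inner bonds of the cube `block n y ⊂ ℤ^d` of `B6TreeGaugePoincare` — and
proves (§3) that the datum is INHABITED for every cube of side `n ≤` the torus period, with `b` = the cube's off-tree
inner bonds read on `T^{(j)}` by reduction of coordinates `mod 2L^{m+K−j}` and `e` = that reduction.

WHAT (THEOREMS ONLY; 0 `def`, 0 `sorry`).
* §1 ★ `ineq19_blockChartSU_of_ineq17`: given `e`, the (1.7) row for the quadratic member `Qf : BlockChartSU N b → ℝ`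
  (curl-form of the 𝔤-valued bond configuration `bd ↦ v (e⁻¹ bd)` extended by zero, against `Σ_{b′} ‖v b′‖²`), `1 ≤ d`,
  `1 ≤ n ≤ 100M`, `0 ≤ γ₀` and the smallness line `C(M⁶R_kε_k + e^{−R_k}) ≤ γ₀∕(2d(100M)^{d+1})` ⇒
  `∀ v, Ineq19 (Qf v) (Σ_{b′} ‖v b′‖²) γ₀ d M` — the `BlockChartSU` ENDs' `h19` VERBATIM (p604008's `sum_sq_flatten` turns
  `Σ_{b′}‖v b′‖²` into the flat sum of squares that (1.8) bounds).
* §2 ★★ `convexOn_blockChartSU_expansion_of_ineq17_analyticSupBound` = file 5's (p613088) ★★′-loc on `BlockChartSU N b` with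
  `h19` DISCHARGED by §1: convexity of the (1.2)-shaped exponent from the (1.7) row + smallness + analyticity letter + clause.
* §3 [folklore] `toPBond_injOn_block` (reduction `mod` the period is injective on the bonds of a cube of side `n ≤ period`) and
  ★ `exists_offTreeBlock_equiv`: for every `y` and `n ≤ P.sitesPerDir j` there are `b : Finset (PBond P j)` and
  `e : ↥b ≃ ↥(innerBonds n y ∖ treeBonds n y)` with `e⁻¹` = reduction of coordinates — the datum of §1 is inhabited at the
  lane's types (A6), non-junk (the clause pins `e`).

HONEST FRAMING.  [textbook]∕[folklore] over file 6, file 5 and p604008 BY NAME; (1.7) stays a DISPLAYED ROW about NODE O's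
operator `Δ₁(ζ₀)`, NOT asserted; which block `b`, cube `block n y` and gauge tree the lane's (M1) package must use is dag-n21-w2 ∕
dag-n21-d's measure-side decision (LOCATED-1 l.30536: tree gauge), not made here; the identification of an END's `Qf` with
⟨H_{1,k}B′, Δ₁(ζ₀)H_{1,k}B′⟩ is LOCATED typing; nothing of Bałaban's asserted; (M1) ∕ NE7c NOT PRINTED ∕ NOT proved; N21 NOT
discharged; K3⁷ NOT claimed; counts unmoved (typed 28∕28 · discharged 5∕27); count-neutral; one finite 𝕋⁴ at fixed ε — the
Yang–Mills mass gap (Clay) is NOT proved by any of this: R4 closes the conditional finite-𝕋⁴ rung `BalabanLadder.UV` only;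
nothing continuum ∕ ℝ⁴ ∕ OS.
-/

set_option autoImplicit false

noncomputable section

open Set Function Finset Matrix Metric

namespace Summit.QuantumFields.YangMills.Theorems.N21ChartExponentCoercivitySUN

open Literature.MathematicalPhysics.QuantumFieldTheory.Balaban1983to89
open Literature.MathematicalPhysics.QuantumFieldTheory.Balaban1983to89.B16Sect1Wilson
  (Ineq17 Ineq18 Ineq19 ineq19_of_17_18 ineq18_cube_vec)
open Literature.MathematicalPhysics.QuantumFieldTheory.Balaban1983to89.B6TreeGaugePoincare
  (Cfg curl innerBonds innerPlaq mem_innerBonds treeBonds_subset_innerBonds)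
open Literature.MathematicalPhysics.QuantumFieldTheory.Balaban1983to89.B6BondElimination (treeBonds unitVec)
open Literature.MathematicalPhysics.QuantumFieldTheory.Balaban1983to89.B6Elimination (block mem_block)
open Summit.QuantumFields.BalabanUV.T4Continuum.ShellMeasureExpChartSUN (BlockChartSU dimSU)
open Summit.QuantumFields.YangMills.Theorems.N21LowCentreEndAtSUNBlockChart (sum_sq_flatten)
open Summit.QuantumFields.YangMills.Theorems.N21ChartExponentConvexityLocalSUN
  (convexOn_blockChartSU_expansion_of_analyticSupBound_local)

variable {N : ℕ} {P : Params} {j : ℕ} {d : ℕ}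

/-! ## §1  ★ The `BlockChartSU` ENDs' (1.9) binder from the (1.7) row + PROVED (1.8), through a bond dictionary -/

section Coercivity

/-- ★ **(1.9) ON `BlockChartSU N b` FROM (1.7) + PROVED (1.8), THROUGH A BOND DICTIONARY.**  Let
`e : ↥b ≃ ↥(innerBonds n y ∖ treeBonds n y)` identify the block's bonds with the off-tree inner bonds of the cube
`block n y ⊂ ℤ^d` (`1 ≤ n ≤ 100M`), and extend a chart vector `v : ↥b → E_N` by zero to a 𝔤-valued bond configuration
(`bd ↦ v (e⁻¹ bd)` off the tree, `0` on the tree and outside).  If the quadratic member obeys print's (1.7) row against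
that configuration's `Σ_{p⊂Λ}|∂·|²` and `Σ_{b′}‖v b′‖²` for every `v`, and the smallness line holds, then
`∀ v, Ineq19 (Qf v) (Σ_{b′} ‖v b′‖²) γ₀ d M`. [cite: Balaban1989LargeFieldII, (1.7)–(1.9) p.358] [folklore] -/
theorem ineq19_blockChartSU_of_ineq17 (b : Finset (PBond P j)) {n : ℕ} (M : ℕ) (hd : 1 ≤ d) (hn : 1 ≤ n)
    (hnM : n ≤ 100 * M) (hM : 0 < M) (y : Fin d → ℤ) (e : ↥b ≃ ↥(innerBonds n y \ treeBonds n y))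
    (Qf : BlockChartSU N b → ℝ) {γ₀ C Rk εk : ℝ} (hγ : 0 ≤ γ₀)
    (h17 : ∀ v : BlockChartSU N b, Ineq17 (Qf v)
      (∑ p ∈ innerPlaq n y, ∑ a : Fin (dimSU N),
        curl (fun bd => if h : bd ∈ innerBonds n y \ treeBonds n y then v (e.symm ⟨bd, h⟩) a else (0 : ℝ))
          p.1 p.2.1 p.2.2 ^ 2)
      (∑ i, ‖v i‖ ^ 2) γ₀ C M Rk εk)
    (hsmall : C * ((M : ℝ) ^ 6 * Rk * εk + Real.exp (-Rk)) ≤ γ₀ / (2 * d * (100 * (M : ℝ)) ^ (d + 1))) :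
    ∀ v : BlockChartSU N b, Ineq19 (Qf v) (∑ i, ‖v i‖ ^ 2) γ₀ d M := by
  intro v
  have hM' : (0 : ℝ) < (M : ℝ) := by exact_mod_cast hM
  have hnB : (0 : ℝ) ≤ ∑ i, ‖v i‖ ^ 2 := Finset.sum_nonneg fun i _ => sq_nonneg _
  -- the extension by zero vanishes on the tree
  have htree : ∀ bd ∈ treeBonds n y,
      (fun a : Fin (dimSU N) =>
        if h : bd ∈ innerBonds n y \ treeBonds n y then v (e.symm ⟨bd, h⟩) a else (0 : ℝ)) = 0 := by
    intro bd hbd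
    funext a
    have : bd ∉ innerBonds n y \ treeBonds n y := fun h => (mem_sdiff.1 h).2 hbd
    simp only [dif_neg this, Pi.zero_apply]
  -- its sum of squares over the cube's bonds is `Σ_{b′} ‖v b′‖²`
  have hsq : ∑ bd ∈ innerBonds n y, ∑ a : Fin (dimSU N),
      (if h : bd ∈ innerBonds n y \ treeBonds n y then v (e.symm ⟨bd, h⟩) a else (0 : ℝ)) ^ 2 = ∑ i, ‖v i‖ ^ 2 := by
    rw [← sum_sdiff (treeBonds_subset_innerBonds (L := n) y)]
    have ht : ∑ bd ∈ treeBonds n y, ∑ a : Fin (dimSU N),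
        (if h : bd ∈ innerBonds n y \ treeBonds n y then v (e.symm ⟨bd, h⟩) a else (0 : ℝ)) ^ 2 = 0 := by
      refine sum_eq_zero fun bd hbd => sum_eq_zero fun a _ => ?_
      have : bd ∉ innerBonds n y \ treeBonds n y := fun h => (mem_sdiff.1 h).2 hbd
      simp only [dif_neg this]
      ring
    rw [ht, add_zero, ← sum_coe_sort (innerBonds n y \ treeBonds n y)]
    have hoff : ∑ s : ↥(innerBonds n y \ treeBonds n y), ∑ a : Fin (dimSU N),
        (if h : (s : (Fin d → ℤ) × Fin d) ∈ innerBonds n y \ treeBonds n y then v (e.symm ⟨s, h⟩) a else (0 : ℝ)) ^ 2 =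
        ∑ s : ↥(innerBonds n y \ treeBonds n y), ∑ a : Fin (dimSU N), (v (e.symm s) a) ^ 2 :=
      sum_congr rfl fun s _ => sum_congr rfl fun a _ => by simp only [dif_pos s.2]
    rw [hoff, ← sum_sq_flatten b v, Fintype.sum_prod_type]
    exact e.symm.sum_comp (fun i : ↥b => ∑ a : Fin (dimSU N), (v i a) ^ 2)
  have h18raw := ineq18_cube_vec (D := dimSU N) M hn hnM y
    (fun (bd : (Fin d → ℤ) × Fin d) (a : Fin (dimSU N)) =>
      if h : bd ∈ innerBonds n y \ treeBonds n y then v (e.symm ⟨bd, h⟩) a else (0 : ℝ)) htree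
  rw [hsq] at h18raw
  exact ineq19_of_17_18 hd hM' hγ hnB (h17 v) h18raw hsmall

end Coercivity

/-! ## §2  ★★ Convexity of the (1.2)-shaped exponent on `BlockChartSU N b` from the (1.7) row -/

section Convexity

/-- ★★ **CONVEXITY ON `BlockChartSU N b` FROM THE (1.7) ROW** = file 5's ★★′-loc
`convexOn_blockChartSU_expansion_of_analyticSupBound_local` with `h19` DISCHARGED by §1 (bond dictionary `e`, (1.7) ∀ v,
smallness line), the analyticity letter and the clause `4·d·(100M)^{d+1}·S ≤ γ₀·r²` as there.
[cite: Balaban1989LargeFieldII, (1.7)–(1.9) p.358] [textbook] -/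
theorem convexOn_blockChartSU_expansion_of_ineq17_analyticSupBound (b : Finset (PBond P j)) {n : ℕ} (M : ℕ)
    (hd : 1 ≤ d) (hn : 1 ≤ n) (hnM : n ≤ 100 * M) (hM : 0 < M) (y : Fin d → ℤ)
    (e : ↥b ≃ ↥(innerBonds n y \ treeBonds n y))
    {K : Set (BlockChartSU N b)} (hK : Convex ℝ K) (φ Qf lin Vt : BlockChartSU N b → ℝ) (c : ℝ)
    (hexp : ∀ v ∈ K, φ v = c + 1 / 2 * Qf v + lin v + Vt v)
    (A : Matrix (↥b × Fin (dimSU N)) (↥b × Fin (dimSU N)) ℝ)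
    (hQf : ∀ v, Qf v = (fun q : ↥b × Fin (dimSU N) => v q.1 q.2) ⬝ᵥ (A *ᵥ fun q => v q.1 q.2))
    {γ₀ C Rk εk : ℝ} (hγ : 0 ≤ γ₀)
    (h17 : ∀ v : BlockChartSU N b, Ineq17 (Qf v)
      (∑ p ∈ innerPlaq n y, ∑ a : Fin (dimSU N),
        curl (fun bd => if h : bd ∈ innerBonds n y \ treeBonds n y then v (e.symm ⟨bd, h⟩) a else (0 : ℝ))
          p.1 p.2.1 p.2.2 ^ 2)
      (∑ i, ‖v i‖ ^ 2) γ₀ C M Rk εk)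
    (hsmall : C * ((M : ℝ) ^ 6 * Rk * εk + Real.exp (-Rk)) ≤ γ₀ / (2 * d * (100 * (M : ℝ)) ^ (d + 1)))
    (ℓ : BlockChartSU N b →ₗ[ℝ] ℝ) (hlin : ∀ v, lin v = ℓ v)
    (Φ : (↥b × Fin (dimSU N) → ℂ) → ℂ) {r S : ℝ} (hr : 0 < r)
    (hVt : ∀ x ∈ K, Vt x = (Φ fun q => ((x q.1 q.2 : ℝ) : ℂ)).re)
    (hΦd : ∀ x ∈ K, DifferentiableOn ℂ Φ (ball (fun q => ((x q.1 q.2 : ℝ) : ℂ)) r))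
    (hΦS : ∀ x ∈ K, ∀ u ∈ ball (fun q : ↥b × Fin (dimSU N) => ((x q.1 q.2 : ℝ) : ℂ)) r, ‖Φ u‖ ≤ S)
    (hclause : 4 * d * (100 * (M : ℝ)) ^ (d + 1) * S ≤ γ₀ * r ^ 2) :
    ConvexOn ℝ K φ :=
  convexOn_blockChartSU_expansion_of_analyticSupBound_local b hK φ Qf lin Vt c hexp A hQf hd (by exact_mod_cast hM)
    (ineq19_blockChartSU_of_ineq17 b M hd hn hnM hM y e Qf hγ h17 hsmall) ℓ hlin Φ hr hVt hΦd hΦS hclause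

end Convexity

/-! ## §3  The bond dictionary exists for every non-wrapping cube of the torus `T^{(j)}` -/

section Dictionary

/-- **REDUCTION `mod` THE PERIOD IS INJECTIVE ON THE BONDS OF A CUBE OF SIDE `n ≤ period`**: two bonds `(z, μ)`, `(z′, μ′)`
with `z, z′ ∈ block n y` and the same image `⟨z mod m, μ⟩ = ⟨z′ mod m, μ′⟩` in `PBond P j` (`m = P.sitesPerDir j ≥ n`)
coincide — coordinatewise `z_i ≡ z′_i (mod m)` with `|z_i − z′_i| < n ≤ m`. [folklore] -/
theorem toPBond_injOn_block {n : ℕ} (hn : n ≤ P.sitesPerDir j) (y : Fin P.d → ℤ) :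
    Set.InjOn (fun bd : (Fin P.d → ℤ) × Fin P.d =>
        (⟨fun i => ((bd.1 i : ℤ) : ZMod (P.sitesPerDir j)), bd.2⟩ : PBond P j))
      {bd | bd.1 ∈ block n y} := by
  intro bd hbd bd' hbd' h
  simp only [Set.mem_setOf_eq] at hbd hbd'
  have hdir : bd.2 = bd'.2 := congrArg PBond.dir h
  have hsrc : ∀ i, ((bd.1 i : ℤ) : ZMod (P.sitesPerDir j)) = ((bd'.1 i : ℤ) : ZMod (P.sitesPerDir j)) :=
    fun i => congrFun (congrArg PBond.src h) i
  have hz : bd.1 = bd'.1 := by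
    funext i
    have hmod := (ZMod.intCast_eq_intCast_iff_dvd_sub _ _ _).1 (hsrc i).symm
    have h1 := mem_block.1 hbd i
    have h2 := mem_block.1 hbd' i
    have hm : (n : ℤ) ≤ (P.sitesPerDir j : ℤ) := by exact_mod_cast hn
    have habs : (bd.1 i - bd'.1 i).natAbs < (P.sitesPerDir j : ℤ).natAbs := by
      rw [Int.natAbs_natCast]
      have : (bd.1 i - bd'.1 i).natAbs < n := by omega
      omega
    have := Int.eq_zero_of_dvd_of_natAbs_lt_natAbs hmod habs
    omega
  exact Prod.ext hz hdir

/-- ★ **THE BOND DICTIONARY EXISTS** (A6 for §1's datum): for every corner `y` and side `n ≤ P.sitesPerDir j` (the cube does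
not wrap around `T^{(j)}`), the off-tree inner bonds of `block n y`, read on the torus by reducing coordinates `mod` the
period, form a `b : Finset (PBond P j)` in bijection `e` with them, and `e⁻¹` IS that reduction (no junk bijection).
[folklore] -/
theorem exists_offTreeBlock_equiv {n : ℕ} (hn : n ≤ P.sitesPerDir j) (y : Fin P.d → ℤ) :
    ∃ (b : Finset (PBond P j)) (e : ↥b ≃ ↥(innerBonds n y \ treeBonds n y)),
      ∀ s : ↥(innerBonds n y \ treeBonds n y),
        ((e.symm s : ↥b) : PBond P j) =
          ⟨fun i => (((s : (Fin P.d → ℤ) × Fin P.d).1 i : ℤ) : ZMod (P.sitesPerDir j)), (s : (Fin P.d → ℤ) × Fin P.d).2⟩ := by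
  classical
  set S : Finset ((Fin P.d → ℤ) × Fin P.d) := innerBonds n y \ treeBonds n y with hS
  set f : (Fin P.d → ℤ) × Fin P.d → PBond P j :=
    fun bd => ⟨fun i => ((bd.1 i : ℤ) : ZMod (P.sitesPerDir j)), bd.2⟩ with hf
  have hinj : Set.InjOn f (S : Set ((Fin P.d → ℤ) × Fin P.d)) := by
    refine (toPBond_injOn_block (P := P) (j := j) hn y).mono fun bd hbd => ?_
    have hbd' : bd ∈ innerBonds n y := (mem_sdiff.1 (Finset.mem_coe.1 hbd)).1
    exact (mem_innerBonds.1 hbd').1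
  have hbij : Set.BijOn f (S : Set ((Fin P.d → ℤ) × Fin P.d)) ((S.image f : Finset (PBond P j)) : Set (PBond P j)) := by
    rw [Finset.coe_image]
    exact hinj.bijOn_image
  refine ⟨S.image f, (hbij.equiv f).symm, fun s => ?_⟩
  rw [Equiv.symm_symm]
  rfl

end Dictionary

end Summit.QuantumFields.YangMills.Theorems.N21ChartExponentCoercivitySUN

end
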